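import Summits.RiemannHypothesis.RiemannHypothesis.Theses.LiPrimeEcho
import Summits.RiemannHypothesis.RiemannHypothesis.Theorems.LiPrimeEchoLiPrimeEdgeEcho
import Summits.RiemannHypothesis.RiemannHypothesis.Theorems.LiPrimeEchoWindowContour
import Summits.RiemannHypothesis.RiemannHypothesis.Theorems.LiPrimeEchoGammaShift
import Summits.RiemannHypothesis.RiemannHypothesis.Theorems.LiPrimeEchoHorizontalEdges
import Summits.RiemannHypothesis.RiemannHypothesis.Theorems.LiPrimeEchoAssembly
import HarnessLib

/-!
# RiemannHypothesis / LiPrimeEcho — CAPSTONE: the Li prime-echo law is a theorem (RH-FREE)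

RH-FREE [rh-li-prover].  Route `Theses/LiPrimeEcho.lean` (rung «Li PRIME-ECHO LAW» L-P(P1e), cell `pub/rh-li`): the route's
`closes` composition applied to the five landed binders — `liPrimeEdgeEcho_proof` (K2, stationary phase of the prime 2),
`liWindowContour_proof` (K1, Bombieri's rectangle), `liGammaShift_proof` (K3), `liHorizontalEdges_proof` (K4),
`liPrimeEcho_assembly_proof` (Assembly) — gives the LEAF

  `LiTheory.LiZeroWindowEcho`: for `c ≥ 5/4` there is `C` with
  `|liZeroTraceWindow n √n (c√n) − liSmoothTraceWindow n √n (c√n) + liPrimeEcho 2 n| ≤ C log² n` (`n ≥ 2`):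
  the zeros of `ζ` in the window `√n ≤ Im ρ ≤ c√n`, weighted by `Re (1 − 1/ρ)ⁿ` and counted with multiplicity at ANY
  real part, differ from the smooth density prediction by exactly (minus) the ECHO of the prime 2,
  `E₂(n) = A₂ n^{1/4} cos(2√(n log 2) + π/4)`, up to `O(log² n)`,

and the corollary `LiZeroWindowEchoTwo` (`liZeroWindowEchoTwo_of`).  Unconditional: no hypothesis on the real parts of
the zeros enters; nothing here bears on the truth of RH.
-/

noncomputable section

-- D-0017: `Summit.<S>.<S>.…` is the designed namespace of a single-problem summit.
set_option linter.dupNamespace false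

namespace Summit.RiemannHypothesis.RiemannHypothesis.Theorems.LiTheory

open Summit.RiemannHypothesis.RiemannHypothesis.Theses.LiPrimeEcho in
/-- **The Li prime-echo law (LEAF of route `LiPrimeEcho`; RH-FREE).**  `LiZeroWindowEcho` is a theorem: the route's
`closes` applied to the five landed binders. -/
theorem liZeroWindowEcho_proof : LiZeroWindowEcho :=
  closes liPrimeEdgeEcho_proof liWindowContour_proof liGammaShift_proof liHorizontalEdges_proof
    liPrimeEcho_assembly_proof

/-- **Corollary** (RH-FREE): `LiZeroWindowEchoTwo` holds. -/
theorem liZeroWindowEchoTwo_holds : LiZeroWindowEchoTwo :=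
  liZeroWindowEchoTwo_of liZeroWindowEcho_proof

end Summit.RiemannHypothesis.RiemannHypothesis.Theorems.LiTheory
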